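import Summits.ValiantsHypothesis.ValiantsHypothesis.Theorems.GrenetZeonDualUnipotentThreeHalvesLongMassMonomialLedger
import Summits.ValiantsHypothesis.ValiantsHypothesis.Theorems.GrenetZeonDualUnipotentThreeHalvesLongMassLedgerTorus
import Summits.ValiantsHypothesis.ValiantsHypothesis.Theorems.GrenetZeonDualUnipotentThreeHalvesLongMassNilCoupling

/-!
# ECHELON LIFT / TOTAL OBSTRUCTION — FL1, FL2ᵃ, ★ FL3ᵃ in the kernel (val-idea-28 g7/g8, lens «degeneration – orbit-closure»;
# crux `GrenetZeon.DualUnipotentThreeHalves` = stmt-ValiantsHypothesis-24318; research statement (c) `SlowCore.LongMassSlowLawInv`)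

Status.  VP ≠ VNP NOT proved.  (c) / 24318 / S3 / R2ᵖ OPEN.  This file asserts NO law toward (c): it TYPES, as `Prop`s over the
landed API (`SlowCore.Ledger` / `RelCert`, `MonomialLedger.SuppWindow` / `coordSpan`), the three statements of the crux idea
`Ideas/echelon-lift.md` (ENEMY SPEC rev 4.4 M1–M3 REOPEN clause «an upper-semicontinuous certificate notion»):

* (FL1) `EchelonExhaustion` — `RelCert` is attained on an ECHELON LIFT `liftSpan T C` of a coordinate span (reduced row echelon form of the
  direction space w.r.t. any injective coordinate weight `w`; pure linear algebra, M-sized).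
* (FL2) `PivotPruning` — if `N₀` is the INITIAL PENCIL of `N` for a cocharacter (`GhostDegeneration N N₀ a w`: the monomials of `N₀` are
  weight-matched to their positions, the remaining «ghost» monomials of `N` sit at positions of strictly larger weight), then the PIVOT SET of
  every order-`k` whole-pencil ledger `K` of `N` is an order-`k` SUPPORT WINDOW of `N₀` (closedness of the ledger condition along the torus
  curve `(N_t, t^w·K) → (N₀, coordSpan (pivots K))`; M/L-sized, the machinery is `InitialForm.LedgerTorus.relCert_curve_zero_of_algebraic_family`).
* (FL3) `LiftableWindowFormula` — ★ the exact price formula: `RelCert n m N P` iff some support window `(T, k)` of the initial pencil LIFTS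
  (`Ledger N ⊤ (liftSpan T C) k` for gap-positive `C`) within budget.  (FL1 ∧ FL2 ⇒ FL3.)

Nothing here is an `IrreducibleInv` constituent or progress on (c); the USE of ★ is on the certification side (total obstruction = finitely
many infeasible lift systems), see the card and `comp-g7/echelon_lift.py` (evidence #55/#56).  No instances, no notation, no sorry.

rev 2 (g7, same session): + KERNEL BRICKS (sorry-free) `liftVec_apply_of_mem`, `linearIndependent_liftVec`, ★ `finrank_liftSpan`
(`finrank (liftSpan T C) = #T` for gap-positive `C`), ★ `relCert_of_lift` (a lifted window certifies `RelCert` BY NAME — the easy half of FL1 in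
(c)'s currency) and ✓ `liftMonotone : LiftMonotone`.  Still open here (paper-true, M / M-L sized): the RREF half of FL1 and FL2.

rev 3 (g8): + the RREF HALF OF FL1 IN THE KERNEL (sorry-free): `exists_lowest` / `mem_pivotSet_iff` / `eq_zero_of_apply_pivotSet_eq_zero`
(the pivot coordinates are injective on `K`), `linearIndependent_of_lowest` (triangularity), ★ `finrank_eq_card_pivotSet`
(`finrank K = # pivotSet w K`), ★ `exists_echelon` (REDUCED ECHELON FORM: `K = liftSpan (pivotSet w K) C` with `C` gap-positive),
✓ `echelonExhaustion_holds : EchelonExhaustion` (FL1 is now a theorem), `pivotSet_liftSpan` (`pivotSet w (liftSpan T C) = T`),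
✓ `formulaFromExhaustionAndPruning : FormulaFromExhaustionAndPruning` and `liftableWindowFormula_of_pivotPruning : PivotPruning →
LiftableWindowFormula` (★ FL3 ⇐ FL2 alone).  Consequence for the certification side: `price_n(N) = min over PIVOT SETS T and orders k of
n·k + n² − #T subject to ONE lift system` is kernel-exact, so a TOTAL-OBSTRUCTION certificate (all minimal windows infeasible) is a kernel
LOWER bound on `RelCert` once each infeasibility is replayed.  Still open here: FL2 (`PivotPruning`).  VP ≠ VNP NOT proved; (c) OPEN.

rev 4 (g8): + FL2 AND ★ FL3 FOR AFFINE PENCILS IN THE KERNEL (sorry-free).  BINDER FIX: as typed in rev 2, (FL2)/(FL3) carry no `IsAffine N`;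
the torus curve `t ↦ diag(t^{-a})·N(t^{-w}x)·diag(t^{a})` is polynomial in `t` exactly for weight-bounded LINEAR pencils (a monomial of degree
`r ≥ 2` at a weight-matched position gets the exponent `(a j − a i)(1 − r) < 0`), and (c) quantifies affine pencils only — so the intended
statements are `PivotPruningAff` / `LiftableWindowFormulaAff` (= FL2 / FL3 with `IsAffine N →` inserted; the rev-2 `Prop`s are kept verbatim and
stay open as typed).  §A ✓ `ledger_curve_zero_coordSpan_pivotSet` — WINDOW CLOSURE along the torus curve of directions: if the members
`curve d F t` (`t ≠ 0`) of a polynomial pencil curve carry the window `(λ_w(t)·K, k)`, then `curve d F 0` carries `(coordSpan (pivotSet w K), k)`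
(valuative criterion ✓ `CurveClosure.eval_ev_zero_of_initial` on the `ℂ[X]`-span `twistFamily w K` of the twists `c ↦ v_c X^{w c}`, whose initial
vectors contain `δ_e`, `e ∈ pivotSet w K`, by ★ `exists_echelon`: `δ_e = lim t^{-w e} λ_w(t) d_e`).  §B the TORUS CURVE of an affine pencil
(`lcoef`, `gap`, `WeightBounded`, `coefPencil`, `gapBound`): ✓ `eval_curve_coefPencil`, ✓ TRANSPORT `curve_map_lineSubst_torusAct`
(`N_t(λ_w(t)x + s·λ_w(t)v) = diag(t^{-a})·N(x + s v)·diag(t^{a})`, `t ≠ 0`), ✓ `windowCone_curve_torusAct` (via `SlowTorus.conj_pow` /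
`totalDegree_conj_le`), ✓ `suppWindow_coefPencil_zero`; bridge ✓ `weightBounded_of_ghostDegeneration`, ✓ `coefPencil_zero_eq_of_ghostDegeneration`
(for affine `N`, `GhostDegeneration N N₀ a w` forces `N₀ =` the gap-zero part); hence ✓ `pivotPruningAff : PivotPruningAff` and
★✓ `liftableWindowFormulaAff : LiftableWindowFormulaAff` — THE EXACT PRICE FORMULA along affine ghost degenerations is a kernel theorem:
`RelCert n m N P ↔ ∃ k T C, GapPositive w T C ∧ SuppWindow N₀ T k ∧ Ledger N ⊤ (liftSpan T C) k ∧ n·k + (n² − #T) ≤ P`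
(`#print axioms` = propext, Classical.choice, Quot.sound).  Instrument #17 is now fully kernel on its certification side; it asserts NO law
toward (c) and is not an `IrreducibleInv` constituent.  VP ≠ VNP NOT proved; (c) / 24318 OPEN.
-/

set_option linter.dupNamespace false
set_option autoImplicit false

noncomputable section

namespace Summit.ValiantsHypothesis.ValiantsHypothesis.Cruxes.DualUnipotentThreeHalves.EchelonLift

open MvPolynomial Matrix
open scoped BigOperators
open Summit.ValiantsHypothesis.ValiantsHypothesis.Cruxes.TwoDimCoefficients.DimTwoCases (AffMat IsAffine)
open Summit.ValiantsHypothesis.ValiantsHypothesis.Theorems.GrenetZeon.SlowCore (Ledger RelCert)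
open Summit.ValiantsHypothesis.ValiantsHypothesis.Theorems.GrenetZeon.MonomialLedger (SuppWindow coordSpan)

variable {n m : ℕ}

/-- The coordinate vector `δ_e`. -/
def delta (e : Fin n × Fin n) : Fin n × Fin n → ℂ := Pi.single e 1

/-- GAP-POSITIVE lift data: a correction runs only from a pivot `e ∈ T` to a NON-pivot `e'` of strictly larger weight. -/
def GapPositive (w : Fin n × Fin n → ℕ) (T : Finset (Fin n × Fin n))
    (C : (Fin n × Fin n) → (Fin n × Fin n) → ℂ) : Prop :=
  ∀ e e', C e e' ≠ 0 → e ∈ T ∧ e' ∉ T ∧ w e < w e'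

/-- The lifted coordinate vector `d_e = δ_e + Σ_{e'} C e e' • δ_{e'}`. -/
def liftVec (C : (Fin n × Fin n) → (Fin n × Fin n) → ℂ) (e : Fin n × Fin n) : Fin n × Fin n → ℂ :=
  delta e + ∑ e' : Fin n × Fin n, C e e' • delta e'

/-- ECHELON LIFT of the coordinate span of `T` by the correction matrix `C` (a point of the Schubert cell with pivot set `T`
when `C` is gap-positive). -/
def liftSpan (T : Finset (Fin n × Fin n)) (C : (Fin n × Fin n) → (Fin n × Fin n) → ℂ) :
    Submodule ℂ (Fin n × Fin n → ℂ) :=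
  Submodule.span ℂ (Set.range fun e : T => liftVec C (e : Fin n × Fin n))

/-- PIVOT SET of a direction space `K` w.r.t. the weight `w`: the positions at which some vector of `K` has its lowest-weight non-zero
coordinate (= the pivots of the reduced echelon form of `K` for increasing `w`; `= in_w K` as a coordinate set). -/
def pivotSet (w : Fin n × Fin n → ℕ) (K : Submodule ℂ (Fin n × Fin n → ℂ)) : Finset (Fin n × Fin n) := by
  classical
  exact Finset.univ.filter fun e => ∃ v ∈ K, v e ≠ 0 ∧ ∀ e', w e' < w e → v e' = 0

/-- **(FL1) ECHELON EXHAUSTION.**  For every pencil and every injective coordinate weight, `RelCert` is attained on an echelon lift of a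
coordinate span with gap-positive corrections (reduced row echelon form of the optimal `K`; `finrank (liftSpan T C) = #T`). -/
def EchelonExhaustion : Prop :=
  ∀ (n m : ℕ) (N : AffMat n m) (w : Fin n × Fin n → ℕ), Function.Injective w → ∀ P : ℕ,
    (RelCert n m N P ↔
      ∃ (k : ℕ) (T : Finset (Fin n × Fin n)) (C : (Fin n × Fin n) → (Fin n × Fin n) → ℂ),
        GapPositive w T C ∧ n * k + (n * n - T.card) ≤ P ∧ Ledger n m N (fun _ => True) (liftSpan T C) k)

/-- **GHOST DEGENERATION.**  `N₀` is the initial pencil of the (homogeneous linear) pencil `N` for the cocharacter `a` on positions and the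
coordinate weights `w`: every monomial `x_c` of `N₀ i j` has `w c = a j − a i` (weight-matched), and every monomial of the difference
`N − N₀` at position `(i,j)` has `w c < a j − a i` (a GHOST at a position of strictly larger weight).  Then
`t ↦ diag(t^{-a}) · N(t^{-w}·x) · diag(t^{a})` is polynomial in `t` with value `N₀` at `t = 0`. -/
def GhostDegeneration (N N₀ : AffMat n m) (a : Fin m → ℤ) (w : Fin n × Fin n → ℕ) : Prop :=
  (∀ i j, MvPolynomial.constantCoeff (N i j) = 0 ∧ MvPolynomial.constantCoeff (N₀ i j) = 0) ∧
  (∀ i j, ∀ d ∈ (N₀ i j).support, ∀ c ∈ d.support, ((w c : ℕ) : ℤ) = a j - a i) ∧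
  (∀ i j, ∀ d ∈ ((N - N₀) i j).support, ∀ c ∈ d.support, ((w c : ℕ) : ℤ) < a j - a i)

/-- **(FL2) PIVOT PRUNING.**  Along a ghost degeneration, the pivot set of every order-`k` whole-pencil ledger of `N` is an order-`k`
SUPPORT WINDOW of the initial pencil `N₀` (`MonomialLedger.SuppWindow`, i.e. by `ledger_coordSpan_iff_suppWindow` a coordinate-span ledger of `N₀`). -/
def PivotPruning : Prop :=
  ∀ (n m : ℕ) (N N₀ : AffMat n m) (a : Fin m → ℤ) (w : Fin n × Fin n → ℕ), Function.Injective w →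
    GhostDegeneration N N₀ a w →
    ∀ (K : Submodule ℂ (Fin n × Fin n → ℂ)) (k : ℕ), Ledger n m N (fun _ => True) K k → SuppWindow N₀ (pivotSet w K) k

/-- **(FL3) ★ LIFTABLE-WINDOW FORMULA.**  Along a ghost degeneration, `RelCert n m N P` holds iff some support window `(T, k)` of the initial
pencil LIFTS within budget: there is a gap-positive `C` with `Ledger N ⊤ (liftSpan T C) k` and `n·k + (n² − #T) ≤ P`.
(`price_n(N) = min {n·k + n² − #T : (T,k) a LIFTABLE support window of N₀}`; FL1 ∧ FL2 ⇒ FL3.) -/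
def LiftableWindowFormula : Prop :=
  ∀ (n m : ℕ) (N N₀ : AffMat n m) (a : Fin m → ℤ) (w : Fin n × Fin n → ℕ), Function.Injective w →
    GhostDegeneration N N₀ a w → ∀ P : ℕ,
    (RelCert n m N P ↔
      ∃ (k : ℕ) (T : Finset (Fin n × Fin n)) (C : (Fin n × Fin n) → (Fin n × Fin n) → ℂ),
        GapPositive w T C ∧ SuppWindow N₀ T k ∧ Ledger n m N (fun _ => True) (liftSpan T C) k ∧ n * k + (n * n - T.card) ≤ P)

/-- The implication recorded in the docstring of (FL3), as a `Prop` (routine once FL1, FL2 and `pivotSet w (liftSpan T C) = T` for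
gap-positive `C` are available). -/
def FormulaFromExhaustionAndPruning : Prop := EchelonExhaustion → PivotPruning → LiftableWindowFormula

/-- **MONOTONICITY of liftability in the budget order** (the obstructed windows form an up-set in `T` at fixed `k` and a down-set in `k`):
restricting an echelon lift to a sub-pivot-set and relaxing the order keep the ledger.  (One line from `SlowCore.ledger_mono` once
`liftSpan T' (C restricted) ≤ liftSpan T C` is noted; recorded as the shape the TOTAL-OBSTRUCTION certificate uses: only MINIMAL windows need
an infeasibility certificate.) -/
def LiftMonotone : Prop :=
  ∀ (n m : ℕ) (N : AffMat n m) (T T' : Finset (Fin n × Fin n)) (C : (Fin n × Fin n) → (Fin n × Fin n) → ℂ) (k k' : ℕ),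
    T' ⊆ T → k ≤ k' → Ledger n m N (fun _ => True) (liftSpan T C) k →
    Ledger n m N (fun _ => True) (liftSpan T' (fun e e' => if e ∈ T' then C e e' else 0)) k'

/-! ## Kernel bricks (sorry-free): the echelon lift has dimension `#T`, so a lifted window certifies by name; monotonicity. -/

/-- On the pivot coordinates a gap-positive lift looks like the coordinate vector. -/
theorem liftVec_apply_of_mem {w : Fin n × Fin n → ℕ} {T : Finset (Fin n × Fin n)}
    {C : (Fin n × Fin n) → (Fin n × Fin n) → ℂ} (hC : GapPositive w T C) (e : Fin n × Fin n)
    {e' : Fin n × Fin n} (he' : e' ∈ T) : liftVec C e e' = if e' = e then 1 else 0 := by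
  classical
  have hCe : C e e' = 0 := by
    by_contra h
    exact (hC e e' h).2.1 he'
  unfold liftVec delta
  simp only [Pi.add_apply, Finset.sum_apply, Pi.smul_apply, Pi.single_apply, smul_eq_mul, mul_ite, mul_one,
    mul_zero, Finset.sum_ite_eq, Finset.mem_univ, if_true, hCe, add_zero]

/-- The lifted vectors of a gap-positive lift are linearly independent. -/
theorem linearIndependent_liftVec {w : Fin n × Fin n → ℕ} {T : Finset (Fin n × Fin n)}
    {C : (Fin n × Fin n) → (Fin n × Fin n) → ℂ} (hC : GapPositive w T C) :
    LinearIndependent ℂ (fun e : T => liftVec C (e : Fin n × Fin n)) := by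
  classical
  let π : (Fin n × Fin n → ℂ) →ₗ[ℂ] (T → ℂ) :=
    { toFun := fun v t => v t, map_add' := fun _ _ => rfl, map_smul' := fun _ _ => rfl }
  refine LinearIndependent.of_comp π ?_
  have hcomp : (π ∘ fun e : T => liftVec C (e : Fin n × Fin n)) = fun e : T => (Pi.basisFun ℂ T) e := by
    funext e
    funext t
    simp only [Function.comp_apply, Pi.basisFun_apply, π, LinearMap.coe_mk, AddHom.coe_mk]
    rw [liftVec_apply_of_mem hC _ t.2, Pi.single_apply]
    simp only [Subtype.ext_iff]
  rw [hcomp]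
  exact (Pi.basisFun ℂ T).linearIndependent

/-- ★ `finrank (liftSpan T C) = #T` for gap-positive `C`. -/
theorem finrank_liftSpan {w : Fin n × Fin n → ℕ} {T : Finset (Fin n × Fin n)}
    {C : (Fin n × Fin n) → (Fin n × Fin n) → ℂ} (hC : GapPositive w T C) :
    Module.finrank ℂ (liftSpan T C) = T.card := by
  classical
  unfold liftSpan
  rw [finrank_span_eq_card (linearIndependent_liftVec hC), Fintype.card_coe]

/-- ★ **CERTIFY BY A LIFTED WINDOW** (the easy half of `EchelonExhaustion`, by name in (c)'s currency): a whole-pencil ledger on a gap-positive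
echelon lift of `T` of order `k` gives `RelCert n m N P` as soon as `n·k + (n² − #T) ≤ P`. -/
theorem relCert_of_lift (N : AffMat n m) {w : Fin n × Fin n → ℕ} {T : Finset (Fin n × Fin n)}
    {C : (Fin n × Fin n) → (Fin n × Fin n) → ℂ} (hC : GapPositive w T C) {k P : ℕ}
    (hL : Ledger n m N (fun _ => True) (liftSpan T C) k) (hP : n * k + (n * n - T.card) ≤ P) : RelCert n m N P :=
  ⟨liftSpan T C, k, hL, by rw [finrank_liftSpan hC]; exact hP⟩

/-- Restricting the lift data to a sub-pivot-set gives a smaller lifted span. -/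
theorem liftSpan_restrict_le (T T' : Finset (Fin n × Fin n)) (C : (Fin n × Fin n) → (Fin n × Fin n) → ℂ) (hT : T' ⊆ T) :
    liftSpan T' (fun e e' => if e ∈ T' then C e e' else 0) ≤ liftSpan T C := by
  classical
  unfold liftSpan
  refine Submodule.span_le.mpr ?_
  rintro v ⟨e, rfl⟩
  have heq : liftVec (fun e e' => if e ∈ T' then C e e' else 0) (e : Fin n × Fin n) = liftVec C (e : Fin n × Fin n) := by
    unfold liftVec
    simp only [e.2, if_true]
  show liftVec (fun e e' => if e ∈ T' then C e e' else 0) (e : Fin n × Fin n) ∈ _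
  rw [heq]
  exact Submodule.subset_span ⟨⟨(e : Fin n × Fin n), hT e.2⟩, rfl⟩

/-- ✓ `LiftMonotone` holds (one line from `SlowCore.ledger_mono`). -/
theorem liftMonotone : LiftMonotone := by
  intro n m N T T' C k k' hT hk hL
  exact Summit.ValiantsHypothesis.ValiantsHypothesis.Theorems.GrenetZeon.SlowCore.ledger_mono hL (fun _ h => h)
    (liftSpan_restrict_le T T' C hT) hk

/-! ## rev 3 (g8): the RREF half of FL1 in the kernel

Linear algebra of the PIVOT SET for an injective coordinate weight `w`: the coordinates in `pivotSet w K` map `K` isomorphically onto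
`ℂ^{pivotSet w K}` (injective: a non-zero vector of `K` has its lowest-weight coordinate in the pivot set; dimension: vectors with distinct
lowest coordinates are independent), the preimages of the coordinate vectors are the REDUCED ROWS `d_e` (`e` a pivot), each `d_e` has `e`
as lowest coordinate and vanishes at the other pivots, so `C e e' := d_e e'` (`e' ∉ T`) is gap-positive and `liftSpan T C = K`. -/

/-- A non-zero vector has a lowest-weight non-zero coordinate. -/
theorem exists_lowest (w : Fin n × Fin n → ℕ) {v : Fin n × Fin n → ℂ} (hv : v ≠ 0) :
    ∃ e₀, v e₀ ≠ 0 ∧ ∀ e', w e' < w e₀ → v e' = 0 := by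
  classical
  have hne : (Finset.univ.filter fun e => v e ≠ 0).Nonempty := by
    by_contra h
    rw [Finset.not_nonempty_iff_eq_empty, Finset.filter_eq_empty_iff] at h
    exact hv (funext fun e => not_not.mp (h (Finset.mem_univ e)))
  obtain ⟨e₀, he₀, hmin⟩ := Finset.exists_min_image _ w hne
  refine ⟨e₀, (Finset.mem_filter.mp he₀).2, fun e' hlt => ?_⟩
  by_contra hne'
  exact (not_le.mpr hlt) (hmin e' (Finset.mem_filter.mpr ⟨Finset.mem_univ _, hne'⟩))

/-- Membership in the pivot set, unfolded. -/
theorem mem_pivotSet_iff (w : Fin n × Fin n → ℕ) {K : Submodule ℂ (Fin n × Fin n → ℂ)} {e : Fin n × Fin n} :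
    e ∈ pivotSet w K ↔ ∃ v ∈ K, v e ≠ 0 ∧ ∀ e', w e' < w e → v e' = 0 := by
  classical
  simp only [pivotSet, Finset.mem_filter, Finset.mem_univ, true_and]

/-- The lowest-weight non-zero coordinate of a vector of `K` is a pivot of `K`. -/
theorem lowest_mem_pivotSet (w : Fin n × Fin n → ℕ) {K : Submodule ℂ (Fin n × Fin n → ℂ)} {v : Fin n × Fin n → ℂ}
    (hvK : v ∈ K) {e₀ : Fin n × Fin n} (h0 : v e₀ ≠ 0) (hmin : ∀ e', w e' < w e₀ → v e' = 0) :
    e₀ ∈ pivotSet w K :=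
  (mem_pivotSet_iff w).mpr ⟨v, hvK, h0, hmin⟩

/-- ★ A vector of `K` that vanishes on the pivot set of `K` is zero (the pivot coordinates are injective on `K`). -/
theorem eq_zero_of_apply_pivotSet_eq_zero (w : Fin n × Fin n → ℕ) {K : Submodule ℂ (Fin n × Fin n → ℂ)}
    {v : Fin n × Fin n → ℂ} (hvK : v ∈ K) (hT : ∀ e ∈ pivotSet w K, v e = 0) : v = 0 := by
  by_contra hv
  obtain ⟨e₀, h0, hmin⟩ := exists_lowest w hv
  exact h0 (hT e₀ (lowest_mem_pivotSet w hvK h0 hmin))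

/-- Vectors with pairwise distinct LOWEST coordinates (w.r.t. an injective weight) are linearly independent (triangularity). -/
theorem linearIndependent_of_lowest (w : Fin n × Fin n → ℕ) (hw : Function.Injective w) {T : Finset (Fin n × Fin n)}
    (u : T → (Fin n × Fin n → ℂ)) (h0 : ∀ t, u t t ≠ 0) (hmin : ∀ (t : T) (e' : Fin n × Fin n), w e' < w t → u t e' = 0) :
    LinearIndependent ℂ u := by
  classical
  rw [linearIndependent_iff']
  intro s g hsum
  by_contra hcon
  push Not at hcon
  obtain ⟨i₀, hi₀s, hgi₀⟩ := hcon
  obtain ⟨i₁, hi₁, hmin₁⟩ := Finset.exists_min_image (s.filter fun i => g i ≠ 0) (fun i : T => w i)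
    ⟨i₀, Finset.mem_filter.mpr ⟨hi₀s, hgi₀⟩⟩
  obtain ⟨hi₁s, hgi₁⟩ := Finset.mem_filter.mp hi₁
  have hcoord := congr_fun hsum (i₁ : Fin n × Fin n)
  rw [Finset.sum_apply, Finset.sum_eq_single i₁, Pi.smul_apply, Pi.zero_apply, smul_eq_mul] at hcoord
  · exact (mul_eq_zero.mp hcoord).elim hgi₁ (h0 i₁)
  · intro i hi hne
    by_cases hgi : g i = 0
    · rw [Pi.smul_apply, hgi, zero_smul]
    · have hle : w (i₁ : Fin n × Fin n) ≤ w i := hmin₁ i (Finset.mem_filter.mpr ⟨hi, hgi⟩)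
      have hne' : w (i₁ : Fin n × Fin n) ≠ w i := fun h => hne (Subtype.ext (hw h)).symm
      rw [Pi.smul_apply, hmin i i₁ (lt_of_le_of_ne hle hne'), smul_zero]
  · exact fun h => absurd hi₁s h

/-- Restriction of coordinate vectors to a coordinate set `T`, as a linear map to `ℂ^T`. -/
def restrictTo (T : Finset (Fin n × Fin n)) : (Fin n × Fin n → ℂ) →ₗ[ℂ] (T → ℂ) where
  toFun v t := v t
  map_add' _ _ := rfl
  map_smul' _ _ := rfl

theorem restrictTo_apply (T : Finset (Fin n × Fin n)) (v : Fin n × Fin n → ℂ) (t : T) : restrictTo T v t = v t := rfl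

/-- The pivot coordinates are injective on `K`. -/
theorem injective_restrict_pivotSet (w : Fin n × Fin n → ℕ) (K : Submodule ℂ (Fin n × Fin n → ℂ)) :
    Function.Injective ((restrictTo (pivotSet w K)).domRestrict K) := by
  refine (injective_iff_map_eq_zero _).mpr fun v hv => ?_
  have h0 : (v : Fin n × Fin n → ℂ) = 0 :=
    eq_zero_of_apply_pivotSet_eq_zero w v.2 fun e he => by
      have h := congr_fun hv ⟨e, he⟩
      simpa only [LinearMap.domRestrict_apply, restrictTo_apply, Pi.zero_apply] using h
  exact (Submodule.coe_eq_zero).mp h0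

/-- ★ `finrank K = # pivotSet w K` (the pivot coordinates are a linear isomorphism `K ≃ ℂ^{pivotSet w K}`). -/
theorem finrank_eq_card_pivotSet (w : Fin n × Fin n → ℕ) (hw : Function.Injective w) (K : Submodule ℂ (Fin n × Fin n → ℂ)) :
    Module.finrank ℂ K = (pivotSet w K).card := by
  classical
  apply le_antisymm
  · calc Module.finrank ℂ K ≤ Module.finrank ℂ (pivotSet w K → ℂ) :=
          LinearMap.finrank_le_finrank_of_injective (injective_restrict_pivotSet w K)
      _ = (pivotSet w K).card := by rw [Module.finrank_fintype_fun_eq_card, Fintype.card_coe]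
  · have hex : ∀ t : pivotSet w K, ∃ v ∈ K, v t ≠ 0 ∧ ∀ e', w e' < w t → v e' = 0 :=
      fun t => (mem_pivotSet_iff w).mp t.2
    choose u huK hu0 humin using hex
    have hli : LinearIndependent ℂ u := linearIndependent_of_lowest w hw u hu0 humin
    have hspan : Submodule.span ℂ (Set.range u) ≤ K :=
      Submodule.span_le.mpr (by rintro _ ⟨t, rfl⟩; exact huK t)
    calc (pivotSet w K).card = Fintype.card (pivotSet w K) := (Fintype.card_coe _).symm
      _ = Module.finrank ℂ (Submodule.span ℂ (Set.range u)) := (finrank_span_eq_card hli).symm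
      _ ≤ Module.finrank ℂ K := Submodule.finrank_mono hspan

/-- On every coordinate, `liftVec C e = δ_e + (row e of C)`. -/
theorem liftVec_apply (C : (Fin n × Fin n) → (Fin n × Fin n) → ℂ) (e c : Fin n × Fin n) :
    liftVec C e c = (if c = e then 1 else 0) + C e c := by
  classical
  unfold liftVec delta
  simp only [Pi.add_apply, Finset.sum_apply, Pi.smul_apply, Pi.single_apply, smul_eq_mul, mul_ite, mul_one,
    mul_zero, Finset.sum_ite_eq, Finset.mem_univ, if_true]

/-- ★ **REDUCED ECHELON FORM.**  Every direction space `K` is the gap-positive echelon lift of the coordinate span of its pivot set: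
`K = liftSpan (pivotSet w K) C` with `C` gap-positive (the rows of `C` are the reduced rows of `K` for increasing `w`, off the pivots). -/
theorem exists_echelon (w : Fin n × Fin n → ℕ) (hw : Function.Injective w) (K : Submodule ℂ (Fin n × Fin n → ℂ)) :
    ∃ C : (Fin n × Fin n) → (Fin n × Fin n) → ℂ, GapPositive w (pivotSet w K) C ∧ liftSpan (pivotSet w K) C = K := by
  classical
  -- the pivot coordinates are a linear isomorphism `K ≃ ℂ^T`, `T = pivotSet w K`
  have hinj : Function.Injective ((restrictTo (pivotSet w K)).domRestrict K) := injective_restrict_pivotSet w K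
  have hsurj : Function.Surjective ((restrictTo (pivotSet w K)).domRestrict K) := by
    have hdim : Module.finrank ℂ K = Module.finrank ℂ (pivotSet w K → ℂ) := by
      rw [finrank_eq_card_pivotSet w hw K, Module.finrank_fintype_fun_eq_card, Fintype.card_coe]
    exact (LinearMap.injective_iff_surjective_of_finrank_eq_finrank hdim).mp hinj
  choose pre hpre using hsurj
  -- the reduced rows `d t` (`t` a pivot): the vector of `K` whose pivot coordinates are `δ_t`
  obtain ⟨d, hdK, hdT⟩ : ∃ d : pivotSet w K → (Fin n × Fin n → ℂ), (∀ t, d t ∈ K) ∧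
      ∀ (t : pivotSet w K) (e' : Fin n × Fin n), e' ∈ pivotSet w K → d t e' = if e' = t then 1 else 0 := by
    refine ⟨fun t => (pre (Pi.single t 1) : Fin n × Fin n → ℂ), fun t => (pre (Pi.single t 1)).2, ?_⟩
    intro t e' he'
    have h := congr_fun (hpre (Pi.single t 1)) ⟨e', he'⟩
    simp only [LinearMap.domRestrict_apply, restrictTo_apply] at h
    show (pre (Pi.single t 1) : Fin n × Fin n → ℂ) e' = _
    rw [h, Pi.single_apply]
    simp only [Subtype.ext_iff]
  -- each reduced row has its pivot as LOWEST coordinate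
  have hdlow : ∀ (t : pivotSet w K) (e' : Fin n × Fin n), w e' < w t → d t e' = 0 := by
    intro t
    have hne : d t ≠ 0 := by
      intro h
      have h1 := hdT t t t.2
      rw [h, Pi.zero_apply, if_pos rfl] at h1
      exact zero_ne_one h1
    obtain ⟨e₀, h0, hmin⟩ := exists_lowest w hne
    have he₀ : e₀ = t := by
      by_contra hne'
      exact h0 (by rw [hdT t e₀ (lowest_mem_pivotSet w (hdK t) h0 hmin), if_neg hne'])
    subst he₀
    exact hmin
  -- the correction matrix: row `e ∈ T` of `C` is the reduced row `d e` off `T`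
  obtain ⟨C, hCT, hCout, hCnot⟩ : ∃ C : (Fin n × Fin n) → (Fin n × Fin n) → ℂ,
      (∀ e e', e' ∈ pivotSet w K → C e e' = 0) ∧
      (∀ e (he : e ∈ pivotSet w K) e', e' ∉ pivotSet w K → C e e' = d ⟨e, he⟩ e') ∧
      (∀ e e', e ∉ pivotSet w K → C e e' = 0) := by
    refine ⟨fun e e' => if h : e ∈ pivotSet w K then (if e' ∈ pivotSet w K then 0 else d ⟨e, h⟩ e') else 0,
      ?_, ?_, ?_⟩
    · intro e e' he'
      by_cases he : e ∈ pivotSet w K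
      · simp [he, he']
      · simp [he]
    · intro e he e' he'
      simp [he, he']
    · intro e e' he
      simp [he]
  -- gap-positivity
  have hGP : GapPositive w (pivotSet w K) C := by
    intro e e' hne
    have he : e ∈ pivotSet w K := by
      by_contra h
      exact hne (hCnot e e' h)
    have he' : e' ∉ pivotSet w K := fun h => hne (hCT e e' h)
    refine ⟨he, he', ?_⟩
    have hd : d ⟨e, he⟩ e' ≠ 0 := by rwa [hCout e he e' he'] at hne
    have hle : w e ≤ w e' := not_lt.mp fun hlt => hd (hdlow ⟨e, he⟩ e' hlt)
    have hne' : e ≠ e' := fun h => he' (by rw [← h]; exact he)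
    exact lt_of_le_of_ne hle fun h => hne' (hw h)
  refine ⟨C, hGP, ?_⟩
  -- the lift is `K`: `liftVec C t = d t` for `t ∈ T`, so `liftSpan T C ≤ K`, and the dimensions agree
  have hlift : ∀ t : pivotSet w K, liftVec C (t : Fin n × Fin n) = d t := by
    intro t
    funext c
    rw [liftVec_apply]
    by_cases hc : c ∈ pivotSet w K
    · rw [hCT _ _ hc, add_zero, hdT t c hc]
    · have hct : c ≠ (t : Fin n × Fin n) := fun h => hc (by rw [h]; exact t.2)
      rw [if_neg hct, zero_add, hCout t t.2 c hc]
  have hle : liftSpan (pivotSet w K) C ≤ K := by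
    unfold liftSpan
    refine Submodule.span_le.mpr ?_
    rintro _ ⟨t, rfl⟩
    show liftVec C (t : Fin n × Fin n) ∈ K
    rw [hlift t]
    exact hdK t
  exact Submodule.eq_of_le_of_finrank_eq hle (by rw [finrank_liftSpan hGP, finrank_eq_card_pivotSet w hw K])

/-- ✓ **(FL1) ECHELON EXHAUSTION holds.** -/
theorem echelonExhaustion_holds : EchelonExhaustion := by
  intro n m N w hw P
  constructor
  · rintro ⟨K, k, hL, hP⟩
    obtain ⟨C, hC, hK⟩ := exists_echelon w hw K
    refine ⟨k, pivotSet w K, C, hC, ?_, ?_⟩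
    · rw [finrank_eq_card_pivotSet w hw K] at hP
      exact hP
    · rw [hK]
      exact hL
  · rintro ⟨k, T, C, hC, hP, hL⟩
    exact relCert_of_lift N hC hL hP

/-- The pivot set of a gap-positive echelon lift is its index set. -/
theorem pivotSet_liftSpan (w : Fin n × Fin n → ℕ) {T : Finset (Fin n × Fin n)}
    {C : (Fin n × Fin n) → (Fin n × Fin n) → ℂ} (hC : GapPositive w T C) : pivotSet w (liftSpan T C) = T := by
  classical
  ext e
  constructor
  · intro he
    obtain ⟨v, hv, hve, hvmin⟩ := (mem_pivotSet_iff w).mp he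
    by_contra heT
    unfold liftSpan at hv
    obtain ⟨g, hgv⟩ := (Submodule.mem_span_range_iff_exists_fun ℂ).mp hv
    -- the coordinate `e ∉ T` of `v` is `∑ g t * C t e ≠ 0`: some `C t₂ e ≠ 0` with `g t₂ ≠ 0`
    have hve' : v e = ∑ t : T, g t * C t e := by
      rw [← hgv, Finset.sum_apply]
      refine Finset.sum_congr rfl fun t _ => ?_
      have hct : e ≠ (t : Fin n × Fin n) := fun h => heT (by rw [h]; exact t.2)
      rw [Pi.smul_apply, smul_eq_mul, liftVec_apply, if_neg hct, zero_add]
    rw [hve'] at hve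
    obtain ⟨t₂, _, ht₂⟩ := Finset.exists_ne_zero_of_sum_ne_zero hve
    have hg₂ : g t₂ ≠ 0 := left_ne_zero_of_mul ht₂
    have hC₂ : C t₂ e ≠ 0 := right_ne_zero_of_mul ht₂
    -- the lowest pivot `t₁` with `g t₁ ≠ 0` is a coordinate of `v` with value `g t₁ ≠ 0` and weight `< w e`
    obtain ⟨t₁, ht₁, hmin₁⟩ := Finset.exists_min_image (Finset.univ.filter fun t : T => g t ≠ 0) (fun t : T => w t)
      ⟨t₂, Finset.mem_filter.mpr ⟨Finset.mem_univ _, hg₂⟩⟩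
    have hgt₁ : g t₁ ≠ 0 := (Finset.mem_filter.mp ht₁).2
    have hvt₁ : v t₁ = g t₁ := by
      rw [← hgv, Finset.sum_apply, Finset.sum_eq_single t₁]
      · rw [Pi.smul_apply, liftVec_apply_of_mem hC _ t₁.2, if_pos rfl, smul_eq_mul, mul_one]
      · intro t _ hne
        rw [Pi.smul_apply, liftVec_apply_of_mem hC _ t₁.2, if_neg (fun h => hne (Subtype.ext h).symm), smul_zero]
      · exact fun h => absurd (Finset.mem_univ _) h
    have hlt : w (t₁ : Fin n × Fin n) < w e :=
      lt_of_le_of_lt (hmin₁ t₂ (Finset.mem_filter.mpr ⟨Finset.mem_univ _, hg₂⟩)) (hC t₂ e hC₂).2.2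
    exact hgt₁ (hvt₁.symm.trans (hvmin t₁ hlt))
  · intro he
    refine (mem_pivotSet_iff w).mpr ⟨liftVec C e, ?_, ?_, ?_⟩
    · exact Submodule.subset_span ⟨⟨e, he⟩, rfl⟩
    · rw [liftVec_apply_of_mem hC e he, if_pos rfl]
      exact one_ne_zero
    · intro e' hlt
      have hne : e' ≠ e := by
        rintro rfl
        exact lt_irrefl _ hlt
      rw [liftVec_apply, if_neg hne, zero_add]
      by_contra hCne
      exact lt_asymm hlt (hC e e' hCne).2.2

/-- ✓ `FormulaFromExhaustionAndPruning` holds (FL1 → FL2 → FL3, via `pivotSet_liftSpan` and `relCert_of_lift`). -/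
theorem formulaFromExhaustionAndPruning : FormulaFromExhaustionAndPruning := by
  intro hFL1 hFL2 n m N N₀ a w hw hG P
  constructor
  · intro hR
    obtain ⟨k, T, C, hC, hP, hL⟩ := (hFL1 n m N w hw P).mp hR
    refine ⟨k, T, C, hC, ?_, hL, hP⟩
    have h := hFL2 n m N N₀ a w hw hG (liftSpan T C) k hL
    rwa [pivotSet_liftSpan w hC] at h
  · rintro ⟨k, T, C, hC, -, hL, hP⟩
    exact relCert_of_lift N hC hL hP

/-- ★ Hence **FL3 ⇐ FL2 alone** in the kernel: `PivotPruning → LiftableWindowFormula`. -/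
theorem liftableWindowFormula_of_pivotPruning (h : PivotPruning) : LiftableWindowFormula :=
  formulaFromExhaustionAndPruning echelonExhaustion_holds h

/-! ## rev 4 (g8) §A.  WINDOW CLOSURE ALONG THE TORUS CURVE OF DIRECTIONS (toward FL2)

Port of the valuative argument ✓ `InitialForm.CurveClosure.eval_ev_zero_of_initial` to the INITIAL SUBSPACE of a direction window: along
`t ↦ λ_w(t)·K` the flat limit at `t = 0` contains `coordSpan (pivotSet w K)` (the reduced rows `d_e` of ★ `exists_echelon` give the initial
vectors `δ_e = lim_{t→0} t^{-w e}·λ_w(t)·d_e`), so any pencil curve `t ↦ curve d F t` whose members carry the window `(λ_w(t)·K, k)` for all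
`t ≠ 0` has `curve d F 0` carrying `(coordSpan (pivotSet w K), k)`:  ✓ `ledger_curve_zero_coordSpan_pivotSet`. -/

section TorusCurveClosure

open scoped Polynomial
open Summit.ValiantsHypothesis.ValiantsHypothesis.Theorems.GrenetZeon.RadicalSplit (lineSubst)
open Summit.ValiantsHypothesis.ValiantsHypothesis.Theorems.GrenetZeon.InitialForm (torusAct)
open Summit.ValiantsHypothesis.ValiantsHypothesis.Theorems.GrenetZeon.InitialForm.TorusClosure (torusAct_zero)
open Summit.ValiantsHypothesis.ValiantsHypothesis.Theorems.GrenetZeon.InitialForm.CurveClosure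
  (ev ev_apply ev_add ev_smul ev_smul_poly eval_ev_zero_of_initial)
open Summit.ValiantsHypothesis.ValiantsHypothesis.Theorems.GrenetZeon.InitialForm.SlowCurve (curve totalDegree_le_iff_coeff)
open Summit.ValiantsHypothesis.ValiantsHypothesis.Theorems.GrenetZeon.InitialForm.LedgerTorus
  (Gp eval_Gp WindowCone ledger_top_iff_windowCone)

/-- The torus TWIST of a direction: `(twist w v) c = v_c · X^{w c}`, so that `ev t (twist w v) = λ_w(t)·v`. -/
def twist (w : Fin n × Fin n → ℕ) (v : Fin n × Fin n → ℂ) : Fin n × Fin n → ℂ[X] :=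
  fun c => Polynomial.C (v c) * Polynomial.X ^ (w c)

theorem ev_twist (w : Fin n × Fin n → ℕ) (v : Fin n × Fin n → ℂ) (t : ℂ) : ev t (twist w v) = torusAct w t v := by
  funext c
  simp only [ev_apply, twist, torusAct, Polynomial.eval_mul, Polynomial.eval_C, Polynomial.eval_pow, Polynomial.eval_X]
  ring

/-- The ALGEBRAIC FAMILY of twisted directions: the `ℂ[X]`-span of the twists of `K` (its fibre at `t ≠ 0` is `λ_w(t)·K`). -/
def twistFamily (w : Fin n × Fin n → ℕ) (K : Submodule ℂ (Fin n × Fin n → ℂ)) : Submodule ℂ[X] (Fin n × Fin n → ℂ[X]) :=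
  Submodule.span ℂ[X] (twist w '' (K : Set (Fin n × Fin n → ℂ)))

theorem torusAct_add (w : Fin n × Fin n → ℕ) (t : ℂ) (u v : Fin n × Fin n → ℂ) :
    torusAct w t (u + v) = torusAct w t u + torusAct w t v := by
  funext c
  simp [torusAct, mul_add]

theorem torusAct_smul (w : Fin n × Fin n → ℕ) (t μ : ℂ) (v : Fin n × Fin n → ℂ) :
    torusAct w t (μ • v) = μ • torusAct w t v := by
  funext c
  simp only [torusAct, Pi.smul_apply, smul_eq_mul]
  ring

/-- Every member of the twisted family evaluates, at every parameter `t`, into the moved window `λ_w(t)·K`. -/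
theorem exists_ev_eq_torusAct (w : Fin n × Fin n → ℕ) (K : Submodule ℂ (Fin n × Fin n → ℂ)) {p : Fin n × Fin n → ℂ[X]}
    (hp : p ∈ twistFamily w K) (t : ℂ) : ∃ v ∈ K, ev t p = torusAct w t v := by
  unfold twistFamily at hp
  induction hp using Submodule.span_induction with
  | mem p hp =>
    obtain ⟨v, hv, rfl⟩ := hp
    exact ⟨v, hv, ev_twist w v t⟩
  | zero =>
    refine ⟨0, K.zero_mem, ?_⟩
    rw [torusAct_zero]
    funext c
    simp
  | add p q _ _ hp hq =>
    obtain ⟨u, hu, hpu⟩ := hp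
    obtain ⟨v, hv, hqv⟩ := hq
    exact ⟨u + v, K.add_mem hu hv, by rw [ev_add, hpu, hqv, torusAct_add]⟩
  | smul g p _ hp =>
    obtain ⟨v, hv, hpv⟩ := hp
    exact ⟨g.eval t • v, K.smul_mem _ hv, by rw [ev_smul_poly, hpv, torusAct_smul]⟩

/-- `s` is an INITIAL VECTOR of the twisted family: `s = u(0)` for some `u` with `X^M • u ∈ twistFamily w K`. -/
def IsInitVec (w : Fin n × Fin n → ℕ) (K : Submodule ℂ (Fin n × Fin n → ℂ)) (s : Fin n × Fin n → ℂ) : Prop :=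
  ∃ (u : Fin n × Fin n → ℂ[X]) (M : ℕ), ev 0 u = s ∧ (Polynomial.X : ℂ[X]) ^ M • u ∈ twistFamily w K

theorem isInitVec_zero (w : Fin n × Fin n → ℕ) (K : Submodule ℂ (Fin n × Fin n → ℂ)) : IsInitVec w K 0 := by
  refine ⟨0, 0, ?_, ?_⟩
  · funext c
    simp
  · rw [smul_zero]
    exact (twistFamily w K).zero_mem

theorem IsInitVec.add {w : Fin n × Fin n → ℕ} {K : Submodule ℂ (Fin n × Fin n → ℂ)} {s₁ s₂ : Fin n × Fin n → ℂ}
    (h₁ : IsInitVec w K s₁) (h₂ : IsInitVec w K s₂) : IsInitVec w K (s₁ + s₂) := by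
  obtain ⟨u₁, M₁, hu₁, hm₁⟩ := h₁
  obtain ⟨u₂, M₂, hu₂, hm₂⟩ := h₂
  refine ⟨u₁ + u₂, M₁ + M₂, by rw [ev_add, hu₁, hu₂], ?_⟩
  rw [smul_add]
  refine (twistFamily w K).add_mem ?_ ?_
  · rw [pow_add, mul_comm, mul_smul]
    exact (twistFamily w K).smul_mem _ hm₁
  · rw [pow_add, mul_smul]
    exact (twistFamily w K).smul_mem _ hm₂

theorem IsInitVec.smul {w : Fin n × Fin n → ℕ} {K : Submodule ℂ (Fin n × Fin n → ℂ)} {s : Fin n × Fin n → ℂ} (μ : ℂ)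
    (h : IsInitVec w K s) : IsInitVec w K (μ • s) := by
  obtain ⟨u, M, hu, hm⟩ := h
  refine ⟨μ • u, M, by rw [ev_smul, hu], ?_⟩
  rw [smul_comm]
  exact (twistFamily w K).smul_of_tower_mem μ hm

theorem lt_of_liftVec_ne_zero {w : Fin n × Fin n → ℕ} {T : Finset (Fin n × Fin n)}
    {Cm : (Fin n × Fin n) → (Fin n × Fin n) → ℂ} (hC : GapPositive w T Cm) {e c : Fin n × Fin n} (hce : c ≠ e)
    (h : liftVec Cm e c ≠ 0) : w e < w c := by
  rw [liftVec_apply, if_neg hce, zero_add] at h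
  exact (hC e c h).2.2

/-- The pivot coordinate vectors are initial vectors: `δ_e = u_e(0)` for `u_e c := d_e(c) · X^{w c − w e}`, where `d_e ∈ K` is the
reduced row of `K` with pivot `e` (★ `exists_echelon`; gap-positivity makes the exponents non-negative) and `X^{w e} • u_e = twist w d_e`. -/
theorem isInitVec_single (w : Fin n × Fin n → ℕ) (hw : Function.Injective w) (K : Submodule ℂ (Fin n × Fin n → ℂ))
    {e : Fin n × Fin n} (he : e ∈ pivotSet w K) : IsInitVec w K (Pi.single e 1) := by
  classical
  obtain ⟨Cm, hC, hK⟩ := exists_echelon w hw K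
  have hdK : liftVec Cm e ∈ K := by
    rw [← hK]
    exact Submodule.subset_span ⟨⟨e, he⟩, rfl⟩
  refine ⟨fun c => Polynomial.C (liftVec Cm e c) * Polynomial.X ^ (w c - w e), w e, ?_, ?_⟩
  · funext c
    simp only [ev_apply, Polynomial.eval_mul, Polynomial.eval_C, Polynomial.eval_pow, Polynomial.eval_X]
    by_cases hce : c = e
    · subst hce
      rw [liftVec_apply_of_mem hC c he, if_pos rfl, Nat.sub_self, pow_zero, mul_one, Pi.single_eq_same]
    · rw [Pi.single_eq_of_ne hce]
      by_cases h0 : liftVec Cm e c = 0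
      · rw [h0, zero_mul]
      · rw [zero_pow (Nat.sub_ne_zero_of_lt (lt_of_liftVec_ne_zero hC hce h0)), mul_zero]
  · have h : (Polynomial.X : ℂ[X]) ^ w e • (fun c => Polynomial.C (liftVec Cm e c) * Polynomial.X ^ (w c - w e)) =
        twist w (liftVec Cm e) := by
      funext c
      simp only [Pi.smul_apply, smul_eq_mul, twist]
      by_cases h0 : liftVec Cm e c = 0
      · simp [h0]
      · have hle : w e ≤ w c := by
          by_cases hce : c = e
          · rw [hce]
          · exact (lt_of_liftVec_ne_zero hC hce h0).le
        rw [mul_left_comm, ← pow_add, Nat.add_sub_cancel' hle]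
    rw [h]
    exact Submodule.subset_span ⟨liftVec Cm e, hdK, rfl⟩

/-- Hence every vector of `coordSpan (pivotSet w K)` is an initial vector of the twisted family of `K`. -/
theorem isInitVec_of_mem_coordSpan (w : Fin n × Fin n → ℕ) (hw : Function.Injective w) (K : Submodule ℂ (Fin n × Fin n → ℂ))
    {s : Fin n × Fin n → ℂ} (hs : s ∈ coordSpan (pivotSet w K)) : IsInitVec w K s := by
  unfold coordSpan at hs
  induction hs using Submodule.span_induction with
  | mem s hs =>
    obtain ⟨e, rfl⟩ := hs
    exact isInitVec_single w hw K e.2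
  | zero => exact isInitVec_zero w K
  | add s₁ s₂ _ _ h₁ h₂ => exact h₁.add h₂
  | smul μ s _ h => exact h.smul μ

/-- ✓ **WINDOW CLOSURE ALONG THE TORUS CURVE OF DIRECTIONS.**  If every member `curve d F t`, `t ≠ 0`, of a polynomial pencil curve carries
the order-`k` window on the torus-moved directions `λ_w(t)·K`, then the special fibre `curve d F 0` carries the order-`k` window on the
coordinate span of the PIVOT SET of `K` (the initial subspace `in_w K`).  [valuative criterion ✓ `CurveClosure.eval_ev_zero_of_initial` +
★ `exists_echelon`; this file] -/
theorem ledger_curve_zero_coordSpan_pivotSet (d : ℕ) (F : ℕ → AffMat n m) (w : Fin n × Fin n → ℕ) (hw : Function.Injective w)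
    (K : Submodule ℂ (Fin n × Fin n → ℂ)) (k : ℕ)
    (hwin : ∀ t : ℂ, t ≠ 0 → ∀ v ∈ K, WindowCone (curve d F t) k (torusAct w t v)) :
    Ledger n m (curve d F 0) (fun _ => True) (coordSpan (pivotSet w K)) k := by
  classical
  set T : Set ℂ := ({0} : Set ℂ)ᶜ with hT
  have hTinf : T.Infinite := (Set.finite_singleton (0 : ℂ)).infinite_compl
  have hT0 : (0 : ℂ) ∉ T := fun h => h rfl
  set 𝓕 : Set (MvPolynomial (Fin n × Fin n) ℂ[X]) :=
    {H | ∃ (x : Fin n × Fin n → ℂ) (p e : ℕ) (a b : Fin m), p ≤ n - 1 ∧ k < e ∧ H = Gp d F x p e a b} with h𝓕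
  have hS : ∀ t ∈ T, ∀ q ∈ twistFamily w K, ∀ H ∈ 𝓕,
      MvPolynomial.eval (ev t q) (MvPolynomial.map (Polynomial.evalRingHom t) H) = 0 := by
    intro t ht q hq H hH
    obtain ⟨x, p, e, a, b, hp, he, rfl⟩ := hH
    obtain ⟨v, hv, hqv⟩ := exists_ev_eq_torusAct w K hq t
    rw [hqv, eval_Gp]
    exact (totalDegree_le_iff_coeff _ k).mp (hwin t ht v hv x p hp a b) e he
  rw [ledger_top_iff_windowCone]
  intro s hs x p hp a b
  obtain ⟨u, M, hus, hu⟩ := isInitVec_of_mem_coordSpan w hw K hs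
  rw [totalDegree_le_iff_coeff]
  intro e he
  rw [← hus, ← eval_Gp d F x p e a b 0 (ev 0 u)]
  exact eval_ev_zero_of_initial (twistFamily w K) 𝓕 T hTinf hT0 hS hu ⟨x, p, e, a, b, hp, he, rfl⟩

end TorusCurveClosure

/-! ## rev 4 (g8) §B.  THE TORUS CURVE OF AN AFFINE PENCIL — ✓ (FL2) for affine ghost degenerations

For an AFFINE pencil `N` (zero constant terms) write `[x_c]N_{ij}` for its linear coefficients.  For a cocharacter `a` on positions and
weights `w` on coordinates, the GAP of `c` at `(i,j)` is `a j − a i − w c`; `N` is WEIGHT-BOUNDED when every occurring coordinate has gap `≥ 0`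
(for affine `N` this is what `GhostDegeneration N N₀ a w` says, with `N₀ =` the gap-zero part, ✓ `coefPencil_zero_eq_of_ghostDegeneration`).
The TORUS CURVE `N_t := Σ_e t^e · (gap-e part)` is a polynomial pencil curve with ✓ `N_t(λ_w(t)x + s·λ_w(t)v) = diag(t^{-a})·N(x + s v)·diag(t^a)`
for `t ≠ 0` (`curve_map_lineSubst_torusAct`), so its members carry every window of `N` moved by `λ_w(t)` (`windowCone_curve_torusAct`,
via ✓ `SlowTorus.conj_pow` / `totalDegree_conj_le`), and §A gives ✓ `suppWindow_coefPencil_zero`: the pivot set of any order-`k` whole-pencil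
ledger of `N` is an order-`k` support window of `N₀`.  Hence ✓ `pivotPruningAff : PivotPruningAff` and ★✓ `liftableWindowFormulaAff`. -/

section AffineTorusCurve

open scoped Polynomial
open Summit.ValiantsHypothesis.ValiantsHypothesis.Theorems.GrenetZeon.RadicalSplit (lineSubst)
open Summit.ValiantsHypothesis.ValiantsHypothesis.Theorems.GrenetZeon.InitialForm (torusAct)
open Summit.ValiantsHypothesis.ValiantsHypothesis.Theorems.GrenetZeon.InitialForm.TorusClosure (torusAct_inv_cancel)
open Summit.ValiantsHypothesis.ValiantsHypothesis.Theorems.GrenetZeon.InitialForm.SlowCurve (curve)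
open Summit.ValiantsHypothesis.ValiantsHypothesis.Theorems.GrenetZeon.InitialForm.SlowTorus (conj_pow totalDegree_conj_le)
open Summit.ValiantsHypothesis.ValiantsHypothesis.Theorems.GrenetZeon.InitialForm.LedgerTorus (WindowCone)
open Summit.ValiantsHypothesis.ValiantsHypothesis.Theorems.GrenetZeon.NilCouplingRow (eval_lineSubst)
open Summit.ValiantsHypothesis.ValiantsHypothesis.Theorems.GrenetZeon.MonomialLedger (ledger_coordSpan_iff_suppWindow)

/-- The linear coefficient `[x_c] N_{ij}`. -/
def lcoef (N : AffMat n m) (i j : Fin m) (c : Fin n × Fin n) : ℂ := MvPolynomial.coeff (Finsupp.single c 1) (N i j)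

/-- The torus GAP of the coordinate `c` at the position `(i, j)`: `a j − a i − w c`. -/
def gap (a : Fin m → ℤ) (w : Fin n × Fin n → ℕ) (i j : Fin m) (c : Fin n × Fin n) : ℤ := a j - a i - (w c : ℤ)

/-- WEIGHT-BOUNDED pencil for `(a, w)`: every coordinate occurring linearly at `(i, j)` has non-negative gap (`w c ≤ a j − a i`). -/
def WeightBounded (N : AffMat n m) (a : Fin m → ℤ) (w : Fin n × Fin n → ℕ) : Prop :=
  ∀ i j c, lcoef N i j c ≠ 0 → 0 ≤ gap a w i j c

/-- The gap-`e` linear coefficients. -/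
def gcoef (N : AffMat n m) (a : Fin m → ℤ) (w : Fin n × Fin n → ℕ) (e : ℕ) (i j : Fin m) (c : Fin n × Fin n) : ℂ :=
  if gap a w i j c = (e : ℤ) then lcoef N i j c else 0

/-- The `e`-th COEFFICIENT PENCIL of the torus curve: the linear part of gap exactly `e` (`e = 0`: the INITIAL PENCIL). -/
def coefPencil (N : AffMat n m) (a : Fin m → ℤ) (w : Fin n × Fin n → ℕ) (e : ℕ) : AffMat n m :=
  fun i j => ∑ c, MvPolynomial.C (gcoef N a w e i j c) * MvPolynomial.X c

/-- A bound for all gaps (the degree of the torus curve). -/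
def gapBound (a : Fin m → ℤ) (w : Fin n × Fin n → ℕ) : ℕ :=
  Finset.univ.sup fun q : Fin m × Fin m × (Fin n × Fin n) => (gap a w q.1 q.2.1 q.2.2).toNat

theorem toNat_gap_le_gapBound (a : Fin m → ℤ) (w : Fin n × Fin n → ℕ) (i j : Fin m) (c : Fin n × Fin n) :
    (gap a w i j c).toNat ≤ gapBound a w :=
  Finset.le_sup (f := fun q : Fin m × Fin m × (Fin n × Fin n) => (gap a w q.1 q.2.1 q.2.2).toNat) (Finset.mem_univ (i, j, c))

theorem eval_coefPencil (N : AffMat n m) (a : Fin m → ℤ) (w : Fin n × Fin n → ℕ) (e : ℕ) (z : Fin n × Fin n → ℂ) (i j : Fin m) :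
    MvPolynomial.eval z (coefPencil N a w e i j) = ∑ c, gcoef N a w e i j c * z c := by
  unfold coefPencil
  rw [map_sum]
  exact Finset.sum_congr rfl fun c _ => by rw [map_mul, MvPolynomial.eval_C, MvPolynomial.eval_X]

/-- The VALUES of the torus curve `N_t := curve (gapBound a w) (coefPencil N a w) t`: `N_t(z)_{ij} = Σ_c t^{gap} · [x_c]N_{ij} · z_c`. -/
theorem eval_curve_coefPencil (N : AffMat n m) (a : Fin m → ℤ) (w : Fin n × Fin n → ℕ) (hwt : WeightBounded N a w) (t : ℂ)
    (z : Fin n × Fin n → ℂ) (i j : Fin m) :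
    MvPolynomial.eval z ((curve (gapBound a w) (coefPencil N a w) t) i j) =
      ∑ c, t ^ (gap a w i j c).toNat * (lcoef N i j c * z c) := by
  unfold curve
  rw [Matrix.sum_apply, map_sum]
  simp_rw [Matrix.smul_apply, MvPolynomial.smul_eval, eval_coefPencil, Finset.mul_sum]
  rw [Finset.sum_comm]
  refine Finset.sum_congr rfl fun c _ => ?_
  unfold gcoef
  by_cases hL : lcoef N i j c = 0
  · simp [hL]
  · have hg : 0 ≤ gap a w i j c := hwt i j c hL
    rw [Finset.sum_eq_single (gap a w i j c).toNat]
    · rw [if_pos (Int.toNat_of_nonneg hg).symm]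
    · intro e _ hne
      rw [if_neg, zero_mul, mul_zero]
      intro h
      apply hne
      rw [h, Int.toNat_natCast]
    · intro h
      exact absurd (Finset.mem_range.mpr (Nat.lt_succ_of_le (toNat_gap_le_gapBound a w i j c))) h

/-- Values of an affine pencil with zero constant terms: `N(y)_{ij} = Σ_c [x_c]N_{ij} · y_c`. [folklore, via ✓ `LRPencil.eq_affine_of_totalDegree_le_one`] -/
theorem eval_eq_sum_lcoef (N : AffMat n m) (hN : IsAffine N) (h0 : ∀ i j, MvPolynomial.constantCoeff (N i j) = 0)
    (y : Fin n × Fin n → ℂ) (i j : Fin m) : MvPolynomial.eval y (N i j) = ∑ c, lcoef N i j c * y c := by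
  have hg := Literature.Computability.AlgebraicComplexity.LRPencil.eq_affine_of_totalDegree_le_one (N i j) (hN i j)
  have hc : MvPolynomial.coeff 0 (N i j) = 0 := h0 i j
  conv_lhs => rw [hg]
  rw [map_add, MvPolynomial.eval_C, hc, zero_add, map_sum]
  exact Finset.sum_congr rfl fun c _ => by rw [map_mul, MvPolynomial.eval_C, MvPolynomial.eval_X, lcoef]

/-- An affine polynomial has no coefficients off `1, x_c`. -/
theorem coeff_eq_zero_of_isAffine (N : AffMat n m) (hN : IsAffine N) (i j : Fin m) {d : Fin n × Fin n →₀ ℕ} (hd0 : d ≠ 0)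
    (hds : ∀ c, Finsupp.single c 1 ≠ d) : MvPolynomial.coeff d (N i j) = 0 := by
  classical
  have hg := Literature.Computability.AlgebraicComplexity.LRPencil.eq_affine_of_totalDegree_le_one (N i j) (hN i j)
  rw [hg, MvPolynomial.coeff_add, MvPolynomial.coeff_C, if_neg (fun h => hd0 h.symm), MvPolynomial.coeff_sum, zero_add]
  refine Finset.sum_eq_zero fun c _ => ?_
  rw [MvPolynomial.coeff_C_mul, MvPolynomial.coeff_X, if_neg (hds c), mul_zero]

/-- ✓ **TRANSPORT.**  For `t ≠ 0` the torus curve pulled back along a moved line is the torus-conjugate of the pencil pulled back along the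
line: `N_t(λ_w(t)x + s·λ_w(t)v) = diag(t^{-a}) · N(x + s v) · diag(t^{a})`. -/
theorem curve_map_lineSubst_torusAct (N : AffMat n m) (hN : IsAffine N) (h0 : ∀ i j, MvPolynomial.constantCoeff (N i j) = 0)
    {a : Fin m → ℤ} {w : Fin n × Fin n → ℕ} (hwt : WeightBounded N a w) {t : ℂ} (ht : t ≠ 0) (x v : Fin n × Fin n → ℂ) :
    (curve (gapBound a w) (coefPencil N a w) t).map (lineSubst (torusAct w t x) (torusAct w t v)) =
      (Matrix.diagonal fun i => t ^ (-(a i))).map MvPolynomial.C * N.map (lineSubst x v) *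
        (Matrix.diagonal fun j => t ^ (a j)).map MvPolynomial.C := by
  refine Matrix.ext fun i j => ?_
  apply MvPolynomial.funext
  intro z
  have hL : MvPolynomial.eval z (((curve (gapBound a w) (coefPencil N a w) t).map (lineSubst (torusAct w t x) (torusAct w t v))) i j)
      = ∑ c, t ^ (gap a w i j c).toNat * (lcoef N i j c * (torusAct w t x c + z 0 * torusAct w t v c)) := by
    rw [Matrix.map_apply, eval_lineSubst, eval_curve_coefPencil N a w hwt]
  have hR : MvPolynomial.eval z ((((Matrix.diagonal fun i => t ^ (-(a i))).map MvPolynomial.C * N.map (lineSubst x v) *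
        (Matrix.diagonal fun j => t ^ (a j)).map MvPolynomial.C : Matrix (Fin m) (Fin m) (MvPolynomial (Fin 1) ℂ))) i j)
      = t ^ (-(a i)) * (∑ c, lcoef N i j c * (x c + z 0 * v c)) * t ^ (a j) := by
    rw [Matrix.diagonal_map (map_zero _), Matrix.diagonal_map (map_zero _), Matrix.mul_diagonal, Matrix.diagonal_mul,
      map_mul, map_mul, MvPolynomial.eval_C, MvPolynomial.eval_C, Matrix.map_apply, eval_lineSubst, eval_eq_sum_lcoef N hN h0]
  rw [hL, hR, Finset.mul_sum, Finset.sum_mul]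
  refine Finset.sum_congr rfl fun c _ => ?_
  by_cases hLc : lcoef N i j c = 0
  · simp [hLc]
  · have hg : 0 ≤ gap a w i j c := hwt i j c hLc
    have key : (t : ℂ) ^ (gap a w i j c).toNat * t ^ (w c) = t ^ (-(a i)) * t ^ (a j) := by
      rw [← zpow_natCast, ← zpow_natCast, ← zpow_add₀ ht, ← zpow_add₀ ht, Int.toNat_of_nonneg hg]
      congr 1
      unfold gap
      ring
    simp only [torusAct]
    linear_combination (lcoef N i j c * (x c + z 0 * v c)) * key

/-- ✓ Along the torus curve, every member `N_t` (`t ≠ 0`) carries every whole-pencil window of `N` moved by `λ_w(t)`. -/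
theorem windowCone_curve_torusAct (N : AffMat n m) (hN : IsAffine N) (h0 : ∀ i j, MvPolynomial.constantCoeff (N i j) = 0)
    {a : Fin m → ℤ} {w : Fin n × Fin n → ℕ} (hwt : WeightBounded N a w) {K : Submodule ℂ (Fin n × Fin n → ℂ)} {k : ℕ}
    (hL : Ledger n m N (fun _ => True) K k) {t : ℂ} (ht : t ≠ 0) {v : Fin n × Fin n → ℂ} (hv : v ∈ K) :
    WindowCone (curve (gapBound a w) (coefPencil N a w) t) k (torusAct w t v) := by
  intro x b hb i j
  rw [← torusAct_inv_cancel w ht x, curve_map_lineSubst_torusAct N hN h0 hwt ht]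
  have hE'E : (Matrix.diagonal fun j => t ^ (a j)).map MvPolynomial.C * (Matrix.diagonal fun i => t ^ (-(a i))).map MvPolynomial.C
      = (1 : Matrix (Fin m) (Fin m) (MvPolynomial (Fin 1) ℂ)) := by
    rw [← Matrix.map_mul, Matrix.diagonal_mul_diagonal]
    have h1 : (fun i => t ^ a i * t ^ (-(a i))) = fun _ => (1 : ℂ) := by
      funext i
      rw [_root_.zpow_neg, mul_inv_cancel₀ (zpow_ne_zero _ ht)]
    rw [h1, Matrix.diagonal_one, Matrix.map_one _ (map_zero _) (map_one _)]
  rcases conj_pow ((Matrix.diagonal fun i => t ^ (-(a i))).map MvPolynomial.C)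
      ((Matrix.diagonal fun j => t ^ (a j)).map MvPolynomial.C) (N.map (lineSubst (torusAct w t⁻¹ x) v)) hE'E b with h | h
  · rw [h]
    have hc := totalDegree_conj_le (Matrix.diagonal fun i => t ^ (-(a i))) (Matrix.diagonal fun j => t ^ (a j)) 1
      ((N.map (lineSubst (torusAct w t⁻¹ x) v)) ^ b) (fun c d => hL _ v hv b hb c d trivial trivial) i j
    rwa [one_smul] at hc
  · subst h
    rw [pow_zero, Matrix.one_apply]
    split_ifs <;> simp

theorem curve_zero_eq (d : ℕ) (F : ℕ → AffMat n m) : curve d F 0 = F 0 := by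
  unfold curve
  rw [Finset.sum_eq_single 0]
  · rw [pow_zero, one_smul]
  · intro e _ he
    rw [zero_pow he, zero_smul]
  · intro h
    exact absurd (Finset.mem_range.mpr (Nat.succ_pos d)) h

/-- ✓ **(FL2) for affine weight-bounded pencils.**  The pivot set of every order-`k` whole-pencil ledger `(K, k)` of `N` is an order-`k`
SUPPORT WINDOW of the initial pencil `coefPencil N a w 0`.  [§A closure + §B transport; this file] -/
theorem suppWindow_coefPencil_zero (N : AffMat n m) (hN : IsAffine N) (h0 : ∀ i j, MvPolynomial.constantCoeff (N i j) = 0)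
    {a : Fin m → ℤ} {w : Fin n × Fin n → ℕ} (hw : Function.Injective w) (hwt : WeightBounded N a w)
    (K : Submodule ℂ (Fin n × Fin n → ℂ)) (k : ℕ) (hL : Ledger n m N (fun _ => True) K k) :
    SuppWindow (coefPencil N a w 0) (pivotSet w K) k := by
  rw [← ledger_coordSpan_iff_suppWindow, ← curve_zero_eq (gapBound a w) (coefPencil N a w)]
  exact ledger_curve_zero_coordSpan_pivotSet _ _ w hw K k fun t ht v hv => windowCone_curve_torusAct N hN h0 hwt hL ht hv

/-- For an affine pencil, a ghost degeneration is weight-bounded … -/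
theorem weightBounded_of_ghostDegeneration (N N₀ : AffMat n m) {a : Fin m → ℤ} {w : Fin n × Fin n → ℕ}
    (hG : GhostDegeneration N N₀ a w) : WeightBounded N a w := by
  intro i j c hL
  have h1 : c ∈ (Finsupp.single c 1).support := by
    rw [Finsupp.mem_support_iff, Finsupp.single_eq_same]
    exact one_ne_zero
  by_cases h : MvPolynomial.coeff (Finsupp.single c 1) (N₀ i j) = lcoef N i j c
  · have hmem : Finsupp.single c 1 ∈ (N₀ i j).support := by
      rw [MvPolynomial.mem_support_iff, h]
      exact hL
    have := hG.2.1 i j _ hmem c h1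
    unfold gap
    omega
  · have hmem : Finsupp.single c 1 ∈ ((N - N₀) i j).support := by
      rw [MvPolynomial.mem_support_iff, Matrix.sub_apply, MvPolynomial.coeff_sub, sub_ne_zero]
      exact fun h' => h h'.symm
    have := hG.2.2 i j _ hmem c h1
    unfold gap
    omega

/-- … and its special fibre IS the gap-zero coefficient pencil: `N₀ = coefPencil N a w 0`. -/
theorem coefPencil_zero_eq_of_ghostDegeneration (N N₀ : AffMat n m) (hN : IsAffine N) {a : Fin m → ℤ} {w : Fin n × Fin n → ℕ}
    (hG : GhostDegeneration N N₀ a w) : coefPencil N a w 0 = N₀ := by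
  classical
  obtain ⟨hc, hwt₀, hgh⟩ := hG
  funext i j
  apply MvPolynomial.ext
  intro d
  have hLHS : MvPolynomial.coeff d (coefPencil N a w 0 i j) =
      ∑ c, gcoef N a w 0 i j c * (if Finsupp.single c 1 = d then 1 else 0) := by
    unfold coefPencil
    rw [MvPolynomial.coeff_sum]
    exact Finset.sum_congr rfl fun c _ => by rw [MvPolynomial.coeff_C_mul, MvPolynomial.coeff_X]
  rw [hLHS]
  by_cases hds : ∃ c₀, Finsupp.single c₀ 1 = d
  · obtain ⟨c₀, rfl⟩ := hds
    have h1 : c₀ ∈ (Finsupp.single c₀ 1).support := by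
      rw [Finsupp.mem_support_iff, Finsupp.single_eq_same]
      exact one_ne_zero
    have hsum : (∑ c, gcoef N a w 0 i j c * (if Finsupp.single c 1 = Finsupp.single c₀ 1 then (1 : ℂ) else 0)) =
        gcoef N a w 0 i j c₀ := by
      rw [Finset.sum_eq_single c₀]
      · rw [if_pos rfl, mul_one]
      · intro c _ hne
        rw [if_neg (fun h => hne (Finsupp.single_left_injective one_ne_zero h)), mul_zero]
      · intro h
        exact absurd (Finset.mem_univ _) h
    rw [hsum]
    unfold gcoef
    split_ifs with hgap
    · by_contra hne
      have hmem : Finsupp.single c₀ 1 ∈ ((N - N₀) i j).support := by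
        rw [MvPolynomial.mem_support_iff, Matrix.sub_apply, MvPolynomial.coeff_sub, sub_ne_zero]
        exact hne
      have := hgh i j _ hmem c₀ h1
      unfold gap at hgap
      omega
    · by_contra hne
      have hmem : Finsupp.single c₀ 1 ∈ (N₀ i j).support := MvPolynomial.mem_support_iff.mpr (Ne.symm hne)
      have := hwt₀ i j _ hmem c₀ h1
      unfold gap at hgap
      omega
  · have hds' : ∀ c, Finsupp.single c 1 ≠ d := fun c h => hds ⟨c, h⟩
    rw [Finset.sum_eq_zero fun c _ => by rw [if_neg (hds' c), mul_zero]]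
    by_contra hne
    have hmem : d ∈ (N₀ i j).support := MvPolynomial.mem_support_iff.mpr (Ne.symm hne)
    by_cases hd0 : d = 0
    · subst hd0
      exact (Ne.symm hne) (hc i j).2
    · obtain ⟨c, hcd⟩ := Finsupp.support_nonempty_iff.mpr hd0
      have hwc := hwt₀ i j d hmem c hcd
      by_cases heq : MvPolynomial.coeff d (N i j) = MvPolynomial.coeff d (N₀ i j)
      · exact (Ne.symm hne) (heq.symm.trans (coeff_eq_zero_of_isAffine N hN i j hd0 hds'))
      · have hmem' : d ∈ ((N - N₀) i j).support := by
          rw [MvPolynomial.mem_support_iff, Matrix.sub_apply, MvPolynomial.coeff_sub, sub_ne_zero]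
          exact heq
        have := hgh i j d hmem' c hcd
        omega

/-- **(FL2ᵃ) PIVOT PRUNING for AFFINE pencils** — (FL2) with the binder `IsAffine N` added (binder fix, rev 4: the torus curve
`t ↦ diag(t^{-a})·N(t^{-w}x)·diag(t^{a})` is polynomial in `t` for weight-bounded LINEAR pencils; (c) quantifies affine pencils only, so this
is the version the certification side uses). -/
def PivotPruningAff : Prop :=
  ∀ (n m : ℕ) (N N₀ : AffMat n m) (a : Fin m → ℤ) (w : Fin n × Fin n → ℕ), Function.Injective w → IsAffine N →
    GhostDegeneration N N₀ a w →
    ∀ (K : Submodule ℂ (Fin n × Fin n → ℂ)) (k : ℕ), Ledger n m N (fun _ => True) K k → SuppWindow N₀ (pivotSet w K) k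

/-- **(FL3ᵃ) ★ LIFTABLE-WINDOW FORMULA for AFFINE pencils** — (FL3) with the binder `IsAffine N` added. -/
def LiftableWindowFormulaAff : Prop :=
  ∀ (n m : ℕ) (N N₀ : AffMat n m) (a : Fin m → ℤ) (w : Fin n × Fin n → ℕ), Function.Injective w → IsAffine N →
    GhostDegeneration N N₀ a w → ∀ P : ℕ,
    (RelCert n m N P ↔
      ∃ (k : ℕ) (T : Finset (Fin n × Fin n)) (C : (Fin n × Fin n) → (Fin n × Fin n) → ℂ),
        GapPositive w T C ∧ SuppWindow N₀ T k ∧ Ledger n m N (fun _ => True) (liftSpan T C) k ∧ n * k + (n * n - T.card) ≤ P)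

/-- ✓ **(FL2ᵃ) holds.** -/
theorem pivotPruningAff : PivotPruningAff := by
  intro n m N N₀ a w hw hN hG K k hL
  rw [← coefPencil_zero_eq_of_ghostDegeneration N N₀ hN hG]
  exact suppWindow_coefPencil_zero N hN (fun i j => (hG.1 i j).1) hw (weightBounded_of_ghostDegeneration N N₀ hG) K k hL

/-- ★✓ **(FL3ᵃ) holds: the exact price formula along affine ghost degenerations.**  `RelCert n m N P` iff some support window `(T, k)` of the
initial pencil `N₀` LIFTS within budget (`price_n(N) = min {n·k + n² − #T : (T, k) a LIFTABLE support window of N₀}`). -/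
theorem liftableWindowFormulaAff : LiftableWindowFormulaAff := by
  intro n m N N₀ a w hw hN hG P
  constructor
  · intro hR
    obtain ⟨k, T, C, hC, hP, hL⟩ := (echelonExhaustion_holds n m N w hw P).mp hR
    refine ⟨k, T, C, hC, ?_, hL, hP⟩
    have h := pivotPruningAff n m N N₀ a w hw hN hG (liftSpan T C) k hL
    rwa [pivotSet_liftSpan w hC] at h
  · rintro ⟨k, T, C, hC, -, hL, hP⟩
    exact relCert_of_lift N hC hL hP

end AffineTorusCurve

end Summit.ValiantsHypothesis.ValiantsHypothesis.Cruxes.DualUnipotentThreeHalves.EchelonLift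

end
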